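import Literature.Analysis.FluidPDE.IteratedSliceDerivatives
import Literature.Analysis.FluidPDE.Ferrari1993LogEstimateReduction
import Literature.Analysis.FluidPDE.LerayHopfProofs
import HarnessLib

/-!
# The `D^α`-energy identity of Ferrari 1993 in the smooth periodic class

Topic `Literature/Analysis/FluidPDE`. Fourth file of the decomposition of the named fact
`Literature.Analysis.FluidPDE.Ferrari1993_periodicCylinderH3Bound`; it supplies the proved
calculus behind the `H^s` energy inequality (13)–(14) of A. B. Ferrari, *On the blow-up of
solutions of the 3-D Euler equations in a bounded domain*, Comm. Math. Phys. **155** (1993),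
p. 280: "we apply `D^α`, `|α| ≤ s`, to both sides of (1), multiply by `D^α u`, and integrate over
`Ω` to obtain
`½ d/dt |D^α u|²_{L²} + (u·D^α∇u, D^α u) + (D^α u, D^α ∇p) = (u·D^α∇u − D^α(u·∇u), D^α u)`,
and since `∇·u = 0` in `Ω` and `u·n = 0` on `∂Ω`, the second term vanishes" — the identity (8).
Here, for a solution `(u, p)` of the smooth periodic class `IsPeriodicCylinderEulerSolution L [0,T) u₀`
in the periodic cylinder and a word `w` of length `m` in the basis `(eᵢ)` of the tree's Sobolev
norm (`sobolevDir w`), the field `W = D_w u` is realised up to the boundary as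
`cylWordField T m w u` (iterated spatial components of the joint derivative,
`jointIterDeriv` of `IteratedSliceDerivatives.lean`), and we **prove**
(`IsPeriodicCylinderEulerSolution.cellEnergyFlux_wordField_le`): for `0 < s < T`,

  `∫_cell 2⟪W(s), ∂ₜW(s)⟫ ≤ 2 ‖W(s)‖_{L²(cell)} (‖[D_w, u·∇]u(s)‖_{L²(cell)} + ‖D_w ∇p(s)‖_{L²(cell)})`,

where `[D_w, u·∇]u = D_w((u·∇)u) − (u·∇)D_w u` is the commutator (`convectionCommutator`), provided
the two right-hand norms are finite. Ingredients: `∂ₜ D_w u = D_w ∂ₜu` at interior points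
(`timeDerivWithin_jointIterDeriv`), the momentum equation differentiated along `w`
(`∂ₜ D_w u = −(u·∇)D_w u − [D_w, u·∇]u − D_w∇p` in `{r < 1}`), the pointwise identity
`2⟪W, (u·∇)W⟫ = div(|W|² u) − |W|² div u` (`two_mul_inner_fderiv_apply_eq`), the Cartesian
Gauss–Green identity on the cell for the tangential periodic field `|W|² u`
(`setIntegral_divergence_cylinderCell_eq_zero`) and the Cauchy–Schwarz inequality in `L²(cell)`
(`abs_integral_inner_le`). Also recorded: continuity and differentiability in time of the cell
energies `∫_cell ‖G(s)‖²` of jointly `C¹` fields (`continuousOn_cellEnergy`,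
`hasDerivAt_cellEnergy`, `continuousOn_cellEnergyFlux`), the `L²` bookkeeping
`∫ ‖f‖² = ‖f‖²_{L²}`, and the smoothness of `(v·∇)v` and `∇q` on open sets of smoothness.
All statements are folklore calculus; the two analytic estimates of Ferrari's Lemmas 1–2 enter
only in `Ferrari1993EnergyInequalityReduction.lean`.
-/

noncomputable section

open MeasureTheory Set Function Filter Topology TopologicalSpace WithLp
open scoped ContDiff NNReal ENNReal InnerProductSpace RealInnerProductSpace

namespace Literature.Analysis.FluidPDE

open Literature.Analysis.FunctionSpaces

/-- Local notation for physical space `ℝ³ = EuclideanSpace ℝ (Fin 3)`. -/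
local notation "ℝ³" => EuclideanSpace ℝ (Fin 3)

/-! ### `L²` bookkeeping -/

section L2

variable {α : Type*} [MeasurableSpace α] {μ : Measure α}
variable {F' : Type*} [NormedAddCommGroup F'] [InnerProductSpace ℝ F']

omit [InnerProductSpace ℝ F'] in
/-- `∫ ‖f‖² = ‖f‖_{L²}²` for `f ∈ L²`. [folklore] -/
theorem integral_norm_sq_eq_toReal_eLpNorm_two_sq [NormedSpace ℝ F'] {f : α → F'} (hf : MemLp f 2 μ) :
    ∫ x, ‖f x‖ ^ 2 ∂μ = ((eLpNorm f 2 μ).toReal) ^ 2 := by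
  rw [hf.eLpNorm_eq_integral_rpow_norm two_ne_zero ENNReal.ofNat_ne_top]
  simp only [ENNReal.toReal_ofNat, Real.rpow_two]
  have h0 : 0 ≤ ∫ x, ‖f x‖ ^ 2 ∂μ := integral_nonneg fun x => by positivity
  have e : (∫ x, ‖f x‖ ^ 2 ∂μ) ^ (2 : ℝ)⁻¹ = Real.sqrt (∫ x, ‖f x‖ ^ 2 ∂μ) := by
    rw [Real.sqrt_eq_rpow, one_div]
  rw [e, ENNReal.toReal_ofReal (Real.sqrt_nonneg _), Real.sq_sqrt h0]

/-- **Cauchy–Schwarz in `L²`**: `|∫ ⟪f, g⟫| ≤ ‖f‖_{L²} ‖g‖_{L²}`. [folklore] -/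
theorem abs_integral_inner_le {f g : α → F'} (hf : MemLp f 2 μ) (hg : MemLp g 2 μ) :
    |∫ x, ⟪f x, g x⟫ ∂μ| ≤ (eLpNorm f 2 μ).toReal * (eLpNorm g 2 μ).toReal := by
  have e : ∫ x, ⟪f x, g x⟫ ∂μ = ⟪hf.toLp f, hg.toLp g⟫ := by
    rw [L2.inner_def]
    refine integral_congr_ae ?_
    filter_upwards [hf.coeFn_toLp, hg.coeFn_toLp] with x hfx hgx
    rw [hfx, hgx]
  rw [e, ← Lp.norm_toLp f hf, ← Lp.norm_toLp g hg]
  exact abs_real_inner_le_norm _ _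

end L2

/-- A function continuous on the closed cylinder is in `L²` of the period cell. [folklore] -/
theorem memLp_two_cylinderCell_of_continuousOn {F' : Type*} [NormedAddCommGroup F'] (L : ℝ)
    {f : ℝ³ → F'} (hf : ContinuousOn f (closure (unitCylinder : Set ℝ³))) :
    MemLp f 2 (volume.restrict (cylinderCell L : Set ℝ³)) := by
  refine ⟨(hf.mono (subset_closure.trans (closure_cylinderCell_subset L))).aestronglyMeasurable
    (cylinderCell L).isOpen.measurableSet, ?_⟩
  exact eLpNorm_restrict_lt_top_of_continuousOn_isCompact (isCompact_closure_cylinderCell L)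
    subset_closure (hf.mono (closure_cylinderCell_subset L)) 2

/-- A function continuous on the open cylinder is a.e. strongly measurable on the period cell.
[folklore] -/
theorem aestronglyMeasurable_cylinderCell_of_continuousOn {F' : Type*} [NormedAddCommGroup F']
    [TopologicalSpace.PseudoMetrizableSpace F'] (L : ℝ) {f : ℝ³ → F'}
    (hf : ContinuousOn f (unitCylinder : Set ℝ³)) :
    AEStronglyMeasurable f (volume.restrict (cylinderCell L : Set ℝ³)) :=
  (hf.mono (cylinderCell_le_unitCylinder L)).aestronglyMeasurable (cylinderCell L).isOpen.measurableSet

/-! ### Cell energies of jointly `C¹` fields -/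

section FieldEnergy

variable {S : Set ℝ} {G : ℝ → ℝ³ → ℝ³} {b : ℝ}

/-- **The cell energy of a jointly `C¹` field is continuous in time**: for `G` jointly `C¹` on
`S × {r ≤ 1}` and `[0, b] ⊆ S`, `s ↦ ∫_cell ‖G(s)‖²` is continuous on `[0, b]` (dominated
convergence, the integrand being bounded on the compact `[0, b] × closure (cell)`). [folklore] -/
theorem continuousOn_cellEnergy
    (hG : ContDiffOn ℝ 1 (uncurry G) (S ×ˢ closure (unitCylinder : Set ℝ³)))
    (hb : Icc (0 : ℝ) b ⊆ S) (L : ℝ) :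
    ContinuousOn (fun s => ∫ x in (cylinderCell L : Set ℝ³), ‖G s x‖ ^ 2) (Icc 0 b) := by
  set Ω : Set ℝ³ := (cylinderCell L : Set ℝ³) with hΩ_def
  have hΩK : closure Ω ⊆ closure (unitCylinder : Set ℝ³) := closure_cylinderCell_subset L
  have hQc : IsCompact (Icc (0 : ℝ) b ×ˢ closure Ω) := isCompact_Icc.prod (isCompact_closure_cylinderCell L)
  have hQsub : Icc (0 : ℝ) b ×ˢ closure Ω ⊆ S ×ˢ closure (unitCylinder : Set ℝ³) := prod_mono hb hΩK
  have cF : ContinuousOn (fun z : ℝ × ℝ³ => ‖G z.1 z.2‖ ^ 2) (Icc 0 b ×ˢ closure Ω) :=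
    (hG.continuousOn.mono hQsub).norm.pow 2
  obtain ⟨C₀, hC₀⟩ := hQc.exists_bound_of_continuousOn cF
  have hιx : ∀ s : ℝ, Continuous fun x : ℝ³ => ((s, x) : ℝ × ℝ³) := fun s =>
    continuous_const.prodMk continuous_id
  have hιs : ∀ x : ℝ³, Continuous fun s : ℝ => ((s, x) : ℝ × ℝ³) := fun x =>
    continuous_id.prodMk continuous_const
  have cFs : ∀ s ∈ Icc (0 : ℝ) b, ContinuousOn (fun x => ‖G s x‖ ^ 2) (closure Ω) :=
    fun s hs => cF.comp (f := fun x : ℝ³ => ((s, x) : ℝ × ℝ³)) (hιx s).continuousOn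
      fun x hx => ⟨hs, hx⟩
  have cFp : ∀ x ∈ closure Ω, ContinuousOn (fun s => ‖G s x‖ ^ 2) (Icc 0 b) :=
    fun x hx => cF.comp (f := fun s : ℝ => ((s, x) : ℝ × ℝ³)) (hιs x).continuousOn
      fun s hs => ⟨hs, hx⟩
  have hΩmeas : MeasurableSet Ω := (cylinderCell L).isOpen.measurableSet
  have hΩfin : volume Ω ≠ ⊤ := (volume_cylinderCell_lt_top L).ne
  have hmemΩ : ∀ᵐ x ∂(volume.restrict Ω), x ∈ closure Ω :=
    (ae_restrict_mem hΩmeas).mono fun x hx => subset_closure hx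
  exact continuousOn_of_dominated (μ := volume.restrict Ω) (bound := fun _ => C₀)
    (fun s hs => ((cFs s hs).mono subset_closure).aestronglyMeasurable hΩmeas)
    (fun s hs => hmemΩ.mono fun x hx => hC₀ (s, x) ⟨hs, hx⟩) (integrableOn_const hΩfin)
    (hmemΩ.mono fun x hx => cFp x hx)

/-- **The energy flux `∫_cell 2⟪G, ∂ₜG⟫` is continuous in time** on `[0, b] ⊆ S` (the one-sided
time derivative of a jointly `C¹` field is jointly continuous up to the boundary,
`continuousOn_uncurry_timeDerivWithin`). [folklore] -/
theorem continuousOn_cellEnergyFlux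
    (hG : ContDiffOn ℝ 1 (uncurry G) (S ×ˢ closure (unitCylinder : Set ℝ³)))
    (hS : UniqueDiffOn ℝ S) (hb : Icc (0 : ℝ) b ⊆ S) (L : ℝ) :
    ContinuousOn (fun s => ∫ x in (cylinderCell L : Set ℝ³), 2 * ⟪G s x, timeDerivWithin S G s x⟫)
      (Icc 0 b) := by
  set Ω : Set ℝ³ := (cylinderCell L : Set ℝ³) with hΩ_def
  have hΩK : closure Ω ⊆ closure (unitCylinder : Set ℝ³) := closure_cylinderCell_subset L
  have hQc : IsCompact (Icc (0 : ℝ) b ×ˢ closure Ω) := isCompact_Icc.prod (isCompact_closure_cylinderCell L)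
  have hQsub : Icc (0 : ℝ) b ×ˢ closure Ω ⊆ S ×ˢ closure (unitCylinder : Set ℝ³) := prod_mono hb hΩK
  have cu' : ContinuousOn (uncurry (timeDerivWithin S G)) (S ×ˢ closure (unitCylinder : Set ℝ³)) :=
    continuousOn_uncurry_timeDerivWithin hG le_rfl hS uniqueDiffOn_closure_unitCylinder
  have cF' : ContinuousOn (fun z : ℝ × ℝ³ => 2 * ⟪G z.1 z.2, timeDerivWithin S G z.1 z.2⟫)
      (Icc 0 b ×ˢ closure Ω) :=
    continuousOn_const.mul ((hG.continuousOn.mono hQsub).inner (cu'.mono hQsub))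
  obtain ⟨C₁, hC₁⟩ := hQc.exists_bound_of_continuousOn cF'
  have hιx : ∀ s : ℝ, Continuous fun x : ℝ³ => ((s, x) : ℝ × ℝ³) := fun s =>
    continuous_const.prodMk continuous_id
  have hιs : ∀ x : ℝ³, Continuous fun s : ℝ => ((s, x) : ℝ × ℝ³) := fun x =>
    continuous_id.prodMk continuous_const
  have cF's : ∀ s ∈ Icc (0 : ℝ) b,
      ContinuousOn (fun x => 2 * ⟪G s x, timeDerivWithin S G s x⟫) (closure Ω) :=
    fun s hs => cF'.comp (f := fun x : ℝ³ => ((s, x) : ℝ × ℝ³)) (hιx s).continuousOn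
      fun x hx => ⟨hs, hx⟩
  have cF'p : ∀ x ∈ closure Ω,
      ContinuousOn (fun s => 2 * ⟪G s x, timeDerivWithin S G s x⟫) (Icc 0 b) :=
    fun x hx => cF'.comp (f := fun s : ℝ => ((s, x) : ℝ × ℝ³)) (hιs x).continuousOn
      fun s hs => ⟨hs, hx⟩
  have hΩmeas : MeasurableSet Ω := (cylinderCell L).isOpen.measurableSet
  have hΩfin : volume Ω ≠ ⊤ := (volume_cylinderCell_lt_top L).ne
  have hmemΩ : ∀ᵐ x ∂(volume.restrict Ω), x ∈ closure Ω :=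
    (ae_restrict_mem hΩmeas).mono fun x hx => subset_closure hx
  exact continuousOn_of_dominated (μ := volume.restrict Ω) (bound := fun _ => C₁)
    (fun s hs => ((cF's s hs).mono subset_closure).aestronglyMeasurable hΩmeas)
    (fun s hs => hmemΩ.mono fun x hx => hC₁ (s, x) ⟨hs, hx⟩) (integrableOn_const hΩfin)
    (hmemΩ.mono fun x hx => cF'p x hx)

/-- **The cell energy is differentiable in time**, with derivative the energy flux: for `G`
jointly `C¹` on `S × {r ≤ 1}`, `[0, b] ⊆ S` and `0 < s < b`,
`d/ds ∫_cell ‖G(s)‖² = ∫_cell 2⟪G(s), ∂ₜG(s)⟫` (differentiation under the integral sign,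
`hasDerivAt_integral_of_dominated_loc_of_deriv_le`). [folklore] -/
theorem hasDerivAt_cellEnergy
    (hG : ContDiffOn ℝ 1 (uncurry G) (S ×ˢ closure (unitCylinder : Set ℝ³)))
    (hS : UniqueDiffOn ℝ S) (hb : Icc (0 : ℝ) b ⊆ S) (L : ℝ) {s : ℝ} (hs : s ∈ Ioo 0 b) :
    HasDerivAt (fun σ => ∫ x in (cylinderCell L : Set ℝ³), ‖G σ x‖ ^ 2)
      (∫ x in (cylinderCell L : Set ℝ³), 2 * ⟪G s x, timeDerivWithin S G s x⟫) s := by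
  set Ω : Set ℝ³ := (cylinderCell L : Set ℝ³) with hΩ_def
  set K : Set ℝ³ := closure (unitCylinder : Set ℝ³) with hK_def
  have hΩK : closure Ω ⊆ K := closure_cylinderCell_subset L
  have hIooS : Ioo 0 b ⊆ S := fun σ hσ => hb (Ioo_subset_Icc_self hσ)
  have hSnhds : ∀ σ ∈ Ioo 0 b, S ∈ 𝓝 σ := fun σ hσ =>
    mem_of_superset (Ioo_mem_nhds hσ.1 hσ.2) hIooS
  have hQc : IsCompact (Icc (0 : ℝ) b ×ˢ closure Ω) := isCompact_Icc.prod (isCompact_closure_cylinderCell L)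
  have hQsub : Icc (0 : ℝ) b ×ˢ closure Ω ⊆ S ×ˢ K := prod_mono hb hΩK
  have cu' : ContinuousOn (uncurry (timeDerivWithin S G)) (S ×ˢ K) :=
    continuousOn_uncurry_timeDerivWithin hG le_rfl hS uniqueDiffOn_closure_unitCylinder
  have cF : ContinuousOn (fun z : ℝ × ℝ³ => ‖G z.1 z.2‖ ^ 2) (Icc 0 b ×ˢ closure Ω) :=
    (hG.continuousOn.mono hQsub).norm.pow 2
  have cF' : ContinuousOn (fun z : ℝ × ℝ³ => 2 * ⟪G z.1 z.2, timeDerivWithin S G z.1 z.2⟫)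
      (Icc 0 b ×ˢ closure Ω) :=
    continuousOn_const.mul ((hG.continuousOn.mono hQsub).inner (cu'.mono hQsub))
  obtain ⟨C₁, hC₁⟩ := hQc.exists_bound_of_continuousOn cF'
  have hιx : ∀ s : ℝ, Continuous fun x : ℝ³ => ((s, x) : ℝ × ℝ³) := fun s =>
    continuous_const.prodMk continuous_id
  have cFs : ∀ s ∈ Icc (0 : ℝ) b, ContinuousOn (fun x => ‖G s x‖ ^ 2) (closure Ω) :=
    fun s hs => cF.comp (f := fun x : ℝ³ => ((s, x) : ℝ × ℝ³)) (hιx s).continuousOn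
      fun x hx => ⟨hs, hx⟩
  have cF's : ∀ s ∈ Icc (0 : ℝ) b,
      ContinuousOn (fun x => 2 * ⟪G s x, timeDerivWithin S G s x⟫) (closure Ω) :=
    fun s hs => cF'.comp (f := fun x : ℝ³ => ((s, x) : ℝ × ℝ³)) (hιx s).continuousOn
      fun x hx => ⟨hs, hx⟩
  have hΩmeas : MeasurableSet Ω := (cylinderCell L).isOpen.measurableSet
  have hΩfin : volume Ω ≠ ⊤ := (volume_cylinderCell_lt_top L).ne
  have hmemΩ : ∀ᵐ x ∂(volume.restrict Ω), x ∈ closure Ω :=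
    (ae_restrict_mem hΩmeas).mono fun x hx => subset_closure hx
  have hintF : ∀ s ∈ Icc (0 : ℝ) b, IntegrableOn (fun x => ‖G s x‖ ^ 2) Ω volume := fun s hs =>
    ((cFs s hs).integrableOn_compact (isCompact_closure_cylinderCell L)).mono_set subset_closure
  have hsI : s ∈ Icc 0 b := Ioo_subset_Icc_self hs
  have hIoo : Ioo 0 b ∈ 𝓝 s := Ioo_mem_nhds hs.1 hs.2
  have key := hasDerivAt_integral_of_dominated_loc_of_deriv_le (μ := volume.restrict Ω)
    (F := fun σ x => ‖G σ x‖ ^ 2)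
    (F' := fun σ x => 2 * ⟪G σ x, timeDerivWithin S G σ x⟫) (x₀ := s)
    (bound := fun _ => C₁) hIoo ?_ (hintF s hsI)
    (((cF's s hsI).mono subset_closure).aestronglyMeasurable hΩmeas) ?_
    (integrableOn_const hΩfin) ?_
  · exact key.2
  · filter_upwards [hIoo] with σ hσ
    exact ((cFs σ (Ioo_subset_Icc_self hσ)).mono subset_closure).aestronglyMeasurable hΩmeas
  · exact hmemΩ.mono fun x hx σ hσ => hC₁ (σ, x) ⟨Ioo_subset_Icc_self hσ, hx⟩
  · refine hmemΩ.mono fun x hx σ hσ => ?_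
    exact (hasDerivAt_time_of_contDiffOn hG one_ne_zero hS (hIooS hσ) (hSnhds σ hσ) (hΩK hx)).norm_sq

end FieldEnergy

/-! ### Pointwise identities and smoothness of the nonlinear terms -/

section Pointwise

variable {E : Type*} [NormedAddCommGroup E] [InnerProductSpace ℝ E] [CompleteSpace E]

variable [FiniteDimensional ℝ E]

omit [CompleteSpace E] in
/-- **The transport term is a divergence up to `div a`**:
`2⟪Y, DY(a)⟫ = div(⟪Y, Y⟫ a) − ⟪Y, Y⟫ div a` at points of differentiability
(`divergence_smul_apply`, `fderiv_inner_self_apply`). For `a = u` divergence free and tangential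
this is the vanishing of `(u·D^α∇u, D^α u)` in Ferrari's (8). [folklore] -/
theorem two_mul_inner_fderiv_apply_eq {Y a : E → E} {x : E} (hY : DifferentiableAt ℝ Y x)
    (ha : DifferentiableAt ℝ a x) :
    2 * ⟪Y x, fderiv ℝ Y x (a x)⟫ =
      VectorCalculus.divergence (fun y => ⟪Y y, Y y⟫ • a y) x - ⟪Y x, Y x⟫ * VectorCalculus.divergence a x := by
  rw [divergence_smul_apply (hY.inner ℝ hY) ha, inner_gradient_right_eq_fderiv, fderiv_inner_self_apply hY]
  ring

omit [CompleteSpace E] [FiniteDimensional ℝ E] in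
/-- `(v·∇)v` is `C^∞` on an open set where `v` is. [folklore] -/
theorem contDiffOn_convect_of_isOpen {U : Set E} (hU : IsOpen U) {v : E → E} (hv : ContDiffOn ℝ ∞ v U) :
    ContDiffOn ℝ ∞ (convect v v) U := by
  have h := ((contDiffOn_infty_iff_fderiv_of_isOpen hU).1 hv).2.clm_apply hv
  exact h.congr fun x _ => rfl

omit [FiniteDimensional ℝ E] in
/-- `∇q` is `C^∞` on an open set where `q` is. [folklore] -/
theorem contDiffOn_gradient_of_isOpen {U : Set E} (hU : IsOpen U) {q : E → ℝ} (hq : ContDiffOn ℝ ∞ q U) :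
    ContDiffOn ℝ ∞ (gradient q) U := by
  have hD : ContDiffOn ℝ ∞ (fderiv ℝ q) U := ((contDiffOn_infty_iff_fderiv_of_isOpen hU).1 hq).2
  have h := (InnerProductSpace.toDual ℝ E).symm.toContinuousLinearEquiv.contDiff.comp_contDiffOn hD
  exact h.congr fun x _ => rfl

omit [CompleteSpace E] [FiniteDimensional ℝ E] in
/-- `x ↦ Df(x)(a x)` is continuous on an open set where `f` is `C^∞` and `a` is continuous. [folklore] -/
theorem continuousOn_fderiv_apply_of_isOpen {F : Type*} [NormedAddCommGroup F] [NormedSpace ℝ F]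
    {U : Set E} (hU : IsOpen U) {f : E → F} (hf : ContDiffOn ℝ ∞ f U) {a : E → E}
    (ha : ContinuousOn a U) : ContinuousOn (fun x => fderiv ℝ f x (a x)) U :=
  ((contDiffOn_infty_iff_fderiv_of_isOpen hU).1 hf).2.continuousOn.clm_apply ha

end Pointwise

/-! ### The word fields of a velocity field and the commutator -/

/-- The directions of a word `w` in the basis `(eᵢ) = Module.finBasis ℝ ℝ³` of the tree's Sobolev
norm on `ℝ³`. [folklore] -/
def sobolevDir {m : ℕ} (w : Fin m → Fin (Module.finrank ℝ ℝ³)) : Fin m → ℝ³ :=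
  fun j => Module.finBasis ℝ ℝ³ (w j)

/-- Unfolding `sobolevDir`. [folklore] -/
@[simp]
theorem sobolevDir_apply {m : ℕ} (w : Fin m → Fin (Module.finrank ℝ ℝ³)) (j : Fin m) :
    sobolevDir w j = Module.finBasis ℝ ℝ³ (w j) := rfl

/-- **The convection commutator** `[D_w, v·∇]v = D_w((v·∇)v) − (v·∇)(D_w v)` of a velocity field
along the word `w` (Ferrari 1993, p. 280: the "difference term" `u·D^α∇u − D^α(u·∇u)` of (8), up to
sign; classical derivatives, meaningful on open sets of smoothness). [folklore] -/
def convectionCommutator (m : ℕ) (w : Fin m → Fin (Module.finrank ℝ ℝ³)) (v : ℝ³ → ℝ³) : ℝ³ → ℝ³ :=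
  fun x => iterDeriv m (sobolevDir w) (convect v v) x - fderiv ℝ (iterDeriv m (sobolevDir w) v) x (v x)

/-- Unfolding `convectionCommutator`. [folklore] -/
theorem convectionCommutator_apply (m : ℕ) (w : Fin m → Fin (Module.finrank ℝ ℝ³)) (v : ℝ³ → ℝ³)
    (x : ℝ³) : convectionCommutator m w v x =
      iterDeriv m (sobolevDir w) (convect v v) x - fderiv ℝ (iterDeriv m (sobolevDir w) v) x (v x) :=
  rfl

/-- **The word field `D_w u` of a time-dependent velocity field, up to the boundary**: the iterated
spatial derivative along `w` read off the joint derivative within `[0, T) × {r ≤ 1}`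
(`jointIterDeriv`); it agrees with `iterDeriv m (sobolevDir w) (u t)` in `{r < 1}`. [folklore] -/
def cylWordField (T : ℝ) (m : ℕ) (w : Fin m → Fin (Module.finrank ℝ ℝ³)) (u : ℝ → ℝ³ → ℝ³) :
    ℝ → ℝ³ → ℝ³ :=
  jointIterDeriv (Ico 0 T) (closure (unitCylinder : Set ℝ³)) m (sobolevDir w) u

section WordField

variable {T : ℝ} {u : ℝ → ℝ³ → ℝ³} {m : ℕ} {w : Fin m → Fin (Module.finrank ℝ ℝ³)}

/-- The word field is jointly `C^∞` up to the boundary if `u` is. [folklore] -/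
theorem contDiffOn_uncurry_cylWordField
    (hu : ContDiffOn ℝ ∞ (uncurry u) (Ico 0 T ×ˢ closure (unitCylinder : Set ℝ³))) :
    ContDiffOn ℝ ∞ (uncurry (cylWordField T m w u)) (Ico 0 T ×ˢ closure (unitCylinder : Set ℝ³)) :=
  contDiffOn_uncurry_jointIterDeriv (uniqueDiffOn_Ico 0 T) uniqueDiffOn_closure_unitCylinder m _ hu

/-- In the open cylinder the word field is the classical iterated derivative of the slice. [folklore] -/
theorem cylWordField_eqOn
    (hu : ContDiffOn ℝ ∞ (uncurry u) (Ico 0 T ×ˢ closure (unitCylinder : Set ℝ³))) {t : ℝ}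
    (ht : t ∈ Ico 0 T) :
    EqOn (cylWordField T m w u t) (iterDeriv m (sobolevDir w) (u t)) (unitCylinder : Set ℝ³) :=
  jointIterDeriv_apply_eq_iterDeriv (uniqueDiffOn_Ico 0 T) uniqueDiffOn_closure_unitCylinder
    unitCylinder.isOpen subset_closure m _ hu ht

/-- The word field of an axially periodic velocity is axially periodic. [folklore] -/
theorem isAxiallyPeriodic_cylWordField {L : ℝ} (hper : ∀ t ∈ Ico 0 T, IsAxiallyPeriodic L (u t))
    {t : ℝ} (ht : t ∈ Ico 0 T) : IsAxiallyPeriodic L (cylWordField T m w u t) :=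
  fun x => jointIterDeriv_add_period (fun y => add_axialShift_mem_closure_unitCylinder_iff L (x := y)) m _
    (fun s hs y => hper s hs y) ht x

/-- **`∂ₜ D_w u = D_w ∂ₜu` in the open cylinder at interior times.** [folklore] -/
theorem timeDerivWithin_cylWordField_eqOn
    (hu : ContDiffOn ℝ ∞ (uncurry u) (Ico 0 T ×ˢ closure (unitCylinder : Set ℝ³))) {t : ℝ}
    (ht : t ∈ Ioo 0 T) :
    EqOn (timeDerivWithin (Ico 0 T) (cylWordField T m w u) t)
      (iterDeriv m (sobolevDir w) (timeDerivWithin (Ico 0 T) u t)) (unitCylinder : Set ℝ³) :=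
  timeDerivWithin_jointIterDeriv (uniqueDiffOn_Ico 0 T) uniqueDiffOn_closure_unitCylinder
    unitCylinder.isOpen subset_closure m _ hu (Ioo_subset_Ico_self ht)
    (mem_of_superset (Ioo_mem_nhds ht.1 ht.2) Ioo_subset_Ico_self)

end WordField

/-! ### The `D^α`-energy identity -/

namespace IsPeriodicCylinderEulerSolution

variable {L T : ℝ} {u₀ : ℝ³ → ℝ³} {u : ℝ → ℝ³ → ℝ³} {p : ℝ → ℝ³ → ℝ}

/-- **The differentiated momentum equation**: in `{r < 1}` at an interior time `s`,
`∂ₜ D_w u = −(u·∇)(D_w u) − [D_w, u·∇]u − D_w ∇p` (apply `D_w` to `∂ₜu = −(u·∇)u − ∇p`, using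
`∂ₜ D_w u = D_w ∂ₜu`, locality and additivity of `D_w` on the open cylinder). [folklore] -/
theorem timeDerivWithin_cylWordField_eq (h : IsPeriodicCylinderEulerSolution L (Ico 0 T) u₀ u p)
    (m : ℕ) (w : Fin m → Fin (Module.finrank ℝ ℝ³)) {s : ℝ} (hs : s ∈ Ioo 0 T) {x : ℝ³}
    (hx : x ∈ (unitCylinder : Set ℝ³)) :
    timeDerivWithin (Ico 0 T) (cylWordField T m w u) s x =
      -(fderiv ℝ (cylWordField T m w u s) x (u s x) + convectionCommutator m w (u s) x +
        iterDeriv m (sobolevDir w) (gradient (p s)) x) := by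
  have hsS : s ∈ Ico 0 T := Ioo_subset_Ico_self hs
  have hU : IsOpen (unitCylinder : Set ℝ³) := unitCylinder.isOpen
  have hus : ContDiffOn ℝ ∞ (u s) (unitCylinder : Set ℝ³) :=
    (contDiffOn_slice_of_contDiffOn_uncurry h.smooth_velocity hsS).mono subset_closure
  have hps : ContDiffOn ℝ ∞ (p s) (unitCylinder : Set ℝ³) :=
    (contDiffOn_slice_of_contDiffOn_uncurry h.smooth_pressure hsS).mono subset_closure
  have hconv : ContDiffOn ℝ ∞ (convect (u s) (u s)) (unitCylinder : Set ℝ³) :=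
    contDiffOn_convect_of_isOpen hU hus
  have hgrad : ContDiffOn ℝ ∞ (gradient (p s)) (unitCylinder : Set ℝ³) :=
    contDiffOn_gradient_of_isOpen hU hps
  -- the momentum equation as an identity of functions on the open cylinder
  have hmom : EqOn (timeDerivWithin (Ico 0 T) u s)
      (fun y => -(convect (u s) (u s) y + gradient (p s) y)) (unitCylinder : Set ℝ³) := by
    intro y hy
    have hm := h.euler.momentum s hsS y hy
    simp only [Pi.zero_apply, add_zero] at hm
    show timeDerivWithin (Ico 0 T) u s y = -(convect (u s) (u s) y + gradient (p s) y)
    rw [eq_sub_of_add_eq hm]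
    abel
  -- differentiate it along `w`
  rw [timeDerivWithin_cylWordField_eqOn h.smooth_velocity hs hx,
    iterDeriv_congr_of_isOpen hU m _ hmom hx, iterDeriv_neg_of_isOpen hU m _ (hconv.add hgrad) hx]
  simp only
  rw [iterDeriv_add_of_isOpen hU m _ hconv hgrad hx]
  -- `D_w((u·∇)u) = (u·∇)D_w u + [D_w, u·∇]u`, and `D(D_w u(s)) = D(W s)` near `x`
  have hW : fderiv ℝ (iterDeriv m (sobolevDir w) (u s)) x = fderiv ℝ (cylWordField T m w u s) x := by
    refine Filter.EventuallyEq.fderiv_eq ?_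
    exact (eventuallyEq_of_mem (hU.mem_nhds hx) (cylWordField_eqOn h.smooth_velocity hsS)).symm
  simp only [convectionCommutator_apply, hW]
  abel

/-- **The `D^α`-energy identity with the transport term integrated away** (Ferrari 1993, (8),
p. 280, in the smooth periodic class): for a solution `(u, p)` of the class
`IsPeriodicCylinderEulerSolution L [0, T) u₀`, `L > 0`, a word `w` of length `m`, `W = D_w u` its
word field (`cylWordField`) and an interior time `0 < s < T`, if the commutator `[D_w, u·∇]u(s)`
and `D_w ∇p(s)` have finite `L²(cell)` norms then
`∫_cell 2⟪W(s), ∂ₜW(s)⟫ ≤ 2 ‖W(s)‖_{L²(cell)} (‖[D_w, u·∇]u(s)‖_{L²(cell)} + ‖D_w∇p(s)‖_{L²(cell)})`.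
Proof: by the differentiated momentum equation and `two_mul_inner_fderiv_apply_eq` with
`div u = 0`, the integrand is `−div(|W|² u) − 2⟪W, [D_w,u·∇]u⟫ − 2⟪W, D_w∇p⟫` on the cell; the
divergence integrates to zero by Gauss–Green (`|W|² u` is `C¹` on the closed cylinder, tangential
on the wall and `L`-periodic — velocity, hence `W`, being periodic), and the other two terms are
bounded by Cauchy–Schwarz. [cite: Ferrari1993, (8) p. 280] -/
theorem cellEnergyFlux_wordField_le (hL : 0 < L) (h : IsPeriodicCylinderEulerSolution L (Ico 0 T) u₀ u p)
    (m : ℕ) (w : Fin m → Fin (Module.finrank ℝ ℝ³)) {s : ℝ} (hs : s ∈ Ioo 0 T)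
    (hcomm : eLpNorm (convectionCommutator m w (u s)) 2
      (volume.restrict (cylinderCell L : Set ℝ³)) ≠ ⊤)
    (hDp : eLpNorm (iterDeriv m (sobolevDir w) (gradient (p s))) 2
      (volume.restrict (cylinderCell L : Set ℝ³)) ≠ ⊤) :
    ∫ x in (cylinderCell L : Set ℝ³),
        2 * ⟪cylWordField T m w u s x, timeDerivWithin (Ico 0 T) (cylWordField T m w u) s x⟫ ≤
      2 * (eLpNorm (cylWordField T m w u s) 2 (volume.restrict (cylinderCell L : Set ℝ³))).toReal *
        ((eLpNorm (convectionCommutator m w (u s)) 2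
            (volume.restrict (cylinderCell L : Set ℝ³))).toReal +
          (eLpNorm (iterDeriv m (sobolevDir w) (gradient (p s))) 2
            (volume.restrict (cylinderCell L : Set ℝ³))).toReal) := by
  -- notation
  set S : Set ℝ := Ico 0 T with hS_def
  set K : Set ℝ³ := closure (unitCylinder : Set ℝ³) with hK_def
  set Ω : Set ℝ³ := (cylinderCell L : Set ℝ³) with hΩ_def
  set W : ℝ → ℝ³ → ℝ³ := cylWordField T m w u with hW_def
  set W' : ℝ³ → ℝ³ := timeDerivWithin S W s with hW'_def
  set comm : ℝ³ → ℝ³ := convectionCommutator m w (u s) with hcomm_def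
  set Dp : ℝ³ → ℝ³ := iterDeriv m (sobolevDir w) (gradient (p s)) with hDp_def
  have hsS : s ∈ S := Ioo_subset_Ico_self hs
  have hS : UniqueDiffOn ℝ S := uniqueDiffOn_Ico 0 T
  have hKu : UniqueDiffOn ℝ K := uniqueDiffOn_closure_unitCylinder
  have hU : IsOpen (unitCylinder : Set ℝ³) := unitCylinder.isOpen
  have hΩU : Ω ⊆ (unitCylinder : Set ℝ³) := cylinderCell_le_unitCylinder L
  have hΩmeas : MeasurableSet Ω := (cylinderCell L).isOpen.measurableSet
  -- smoothness
  have hu : ContDiffOn ℝ ∞ (uncurry u) (S ×ˢ K) := h.smooth_velocity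
  have hW : ContDiffOn ℝ ∞ (uncurry W) (S ×ˢ K) := contDiffOn_uncurry_cylWordField hu
  have hWs : ContDiffOn ℝ ∞ (W s) K := contDiffOn_slice_of_contDiffOn_uncurry hW hsS
  have hus : ContDiffOn ℝ ∞ (u s) K := contDiffOn_slice_of_contDiffOn_uncurry hu hsS
  have hps : ContDiffOn ℝ ∞ (p s) K := contDiffOn_slice_of_contDiffOn_uncurry h.smooth_pressure hsS
  have hWs1 : ContDiffOn ℝ 1 (W s) K := hWs.of_le (by exact_mod_cast le_top)
  have hus1 : ContDiffOn ℝ 1 (u s) K := hus.of_le (by exact_mod_cast le_top)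
  have cW' : ContinuousOn W' K := by
    have c := continuousOn_uncurry_timeDerivWithin (hW.of_le (by exact_mod_cast le_top)) le_rfl hS hKu
    exact c.comp (f := fun x : ℝ³ => ((s, x) : ℝ × ℝ³)) (continuous_const.prodMk continuous_id).continuousOn
      fun x hx => ⟨hsS, hx⟩
  have husU : ContDiffOn ℝ ∞ (u s) (unitCylinder : Set ℝ³) := hus.mono subset_closure
  have hconv : ContDiffOn ℝ ∞ (convect (u s) (u s)) (unitCylinder : Set ℝ³) :=
    contDiffOn_convect_of_isOpen hU husU
  have hgrad : ContDiffOn ℝ ∞ (gradient (p s)) (unitCylinder : Set ℝ³) :=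
    contDiffOn_gradient_of_isOpen hU (hps.mono subset_closure)
  have ccomm : ContinuousOn comm (unitCylinder : Set ℝ³) :=
    ((ContDiffOn.iterDeriv_of_isOpen hU m _ hconv).continuousOn).sub
      (continuousOn_fderiv_apply_of_isOpen hU (ContDiffOn.iterDeriv_of_isOpen hU m _ husU) husU.continuousOn)
  have cDp : ContinuousOn Dp (unitCylinder : Set ℝ³) := (ContDiffOn.iterDeriv_of_isOpen hU m _ hgrad).continuousOn
  -- `L²` memberships on the cell
  have mW : MemLp (W s) 2 (volume.restrict Ω) := memLp_two_cylinderCell_of_continuousOn L hWs.continuousOn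
  have mcomm : MemLp comm 2 (volume.restrict Ω) := ⟨aestronglyMeasurable_cylinderCell_of_continuousOn L ccomm,
    lt_top_iff_ne_top.2 hcomm⟩
  have mDp : MemLp Dp 2 (volume.restrict Ω) := ⟨aestronglyMeasurable_cylinderCell_of_continuousOn L cDp,
    lt_top_iff_ne_top.2 hDp⟩
  -- the flux field `V = ⟪W, W⟫ u(s)` and Gauss–Green
  set V : ℝ³ → ℝ³ := fun y => ⟪W s y, W s y⟫ • u s y with hV
  have hVc : ContDiffOn ℝ 1 V K := (hWs1.inner ℝ hWs1).smul hus1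
  have hWper : ∀ y, W s (y + L • EuclideanSpace.single (2 : Fin 3) (1 : ℝ)) = W s y :=
    isAxiallyPeriodic_cylWordField (fun t ht => (h.periodic t ht).1) hsS
  have hVper : IsAxiallyPeriodic L V := fun y => by
    simp only [hV, (h.periodic s hsS).1 y, hWper y]
  have hVslip : ∀ x ∈ frontier (unitCylinder : Set ℝ³), ⟪V x, eR x⟫ = 0 := fun x hx => by
    simp only [hV, inner_smul_left, h.euler.slip s hsS x hx, mul_zero]
  have hflux : ∫ x in Ω, VectorCalculus.divergence V x = 0 :=
    setIntegral_divergence_cylinderCell_eq_zero hL hVc hVslip hVper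
  -- the integrands
  set F₀ : ℝ³ → ℝ := fun x => 2 * ⟪W s x, W' x⟫ with hF₀
  set R₁ : ℝ³ → ℝ := fun x => 2 * ⟪W s x, comm x⟫ with hR₁
  set R₂ : ℝ³ → ℝ := fun x => 2 * ⟪W s x, Dp x⟫ with hR₂
  set D : ℝ³ → ℝ := fun x => VectorCalculus.divergence V x with hD
  -- pointwise identity on the cell
  have hpt : ∀ x ∈ Ω, F₀ x = -D x - R₁ x - R₂ x := by
    intro x hx
    have hxU : x ∈ (unitCylinder : Set ℝ³) := hΩU hx
    have hKx : K ∈ 𝓝 x := closure_unitCylinder_mem_nhds hxU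
    have hxK : x ∈ K := subset_closure hxU
    have dW : DifferentiableAt ℝ (W s) x := (hWs1.differentiableOn one_ne_zero x hxK).differentiableAt hKx
    have du : DifferentiableAt ℝ (u s) x := (hus1.differentiableOn one_ne_zero x hxK).differentiableAt hKx
    have e1 : W' x = -(fderiv ℝ (W s) x (u s x) + comm x + Dp x) :=
      h.timeDerivWithin_cylWordField_eq m w hs hxU
    have e2 := two_mul_inner_fderiv_apply_eq (a := u s) dW du
    rw [h.euler.divFree s hsS x hxU, mul_zero, sub_zero] at e2
    simp only [hF₀, hR₁, hR₂, hD, hV, e1, inner_neg_right, inner_add_right]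
    linarith [e2]
  -- integrability
  have iF₀ : IntegrableOn F₀ Ω volume := by
    have c : ContinuousOn F₀ K := continuousOn_const.mul (hWs.continuousOn.inner cW')
    exact ((c.mono (closure_cylinderCell_subset L)).integrableOn_compact
      (isCompact_closure_cylinderCell L)).mono_set subset_closure
  have iR₁ : Integrable R₁ (volume.restrict Ω) := (integrable_inner_of_memLp_two mW mcomm).const_mul 2
  have iR₂ : Integrable R₂ (volume.restrict Ω) := (integrable_inner_of_memLp_two mW mDp).const_mul 2
  have haeF : F₀ =ᵐ[(volume.restrict Ω)] fun x => -D x - R₁ x - R₂ x := ae_restrict_of_forall_mem hΩmeas hpt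
  have iD : Integrable D (volume.restrict Ω) := by
    have h1 : Integrable (fun x => -F₀ x - R₁ x - R₂ x) (volume.restrict Ω) := (iF₀.neg.sub iR₁).sub iR₂
    refine h1.congr (ae_restrict_of_forall_mem hΩmeas fun x hx => ?_)
    simp only [hpt x hx]
    ring
  -- Cauchy–Schwarz
  have hCS₁ : |∫ x in Ω, ⟪W s x, comm x⟫| ≤ (eLpNorm (W s) 2 (volume.restrict Ω)).toReal * (eLpNorm comm 2 (volume.restrict Ω)).toReal :=
    abs_integral_inner_le mW mcomm
  have hCS₂ : |∫ x in Ω, ⟪W s x, Dp x⟫| ≤ (eLpNorm (W s) 2 (volume.restrict Ω)).toReal * (eLpNorm Dp 2 (volume.restrict Ω)).toReal :=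
    abs_integral_inner_le mW mDp
  -- assemble
  have eI : ∫ x in Ω, F₀ x = -(∫ x in Ω, R₁ x) - ∫ x in Ω, R₂ x := by
    calc ∫ x in Ω, F₀ x = ∫ x in Ω, (-D x - R₁ x - R₂ x) := integral_congr_ae haeF
      _ = -(∫ x in Ω, D x) - (∫ x in Ω, R₁ x) - ∫ x in Ω, R₂ x := by
          have iDn : Integrable (fun x => -D x) (volume.restrict Ω) := iD.neg
          have i1 : Integrable (fun x => -D x - R₁ x) (volume.restrict Ω) := iDn.sub iR₁
          rw [integral_sub i1 iR₂, integral_sub iDn iR₁, integral_neg]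
      _ = -(∫ x in Ω, R₁ x) - ∫ x in Ω, R₂ x := by rw [show (∫ x in Ω, D x) = 0 from hflux]; ring
  have eR₁ : ∫ x in Ω, R₁ x = 2 * ∫ x in Ω, ⟪W s x, comm x⟫ := integral_const_mul _ _
  have eR₂ : ∫ x in Ω, R₂ x = 2 * ∫ x in Ω, ⟪W s x, Dp x⟫ := integral_const_mul _ _
  have h1 := neg_le_abs (∫ x in Ω, ⟪W s x, comm x⟫)
  have h2 := neg_le_abs (∫ x in Ω, ⟪W s x, Dp x⟫)
  have key : ∫ x in Ω, F₀ x ≤ 2 * (eLpNorm (W s) 2 (volume.restrict Ω)).toReal *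
      ((eLpNorm comm 2 (volume.restrict Ω)).toReal + (eLpNorm Dp 2 (volume.restrict Ω)).toReal) := by
    rw [eI, eR₁, eR₂]
    nlinarith [hCS₁, hCS₂, h1, h2]
  exact key

end IsPeriodicCylinderEulerSolution

end Literature.Analysis.FluidPDE
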